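import Summits.Ventures.LatticeQCDFlow.Scaling.AdjacentPerStepCoupling
import Summits.Ventures.LatticeQCDFlow.Scaling.CompositionProductBracketSigned

/-!
HONEST FRAMING: exact (Metropolis-corrected) sampling algorithms for lattice gauge theory; figures
of merit are autocorrelation/cost numbers at stated couplings and volumes; no continuum-physics
claim.

# AdjacentPerStepBracket — THE PRODUCT POTENTIAL OF AN ADJACENT PAIR AFTER ONE CYCLE WITH `j` ATTEMPTS: `E_π[Δ'Φ'] ≤ Φ + e − R_X − R_Y − (Φ+e−2)·G + (u_Y(z) − u_X(z))⁺`,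
# `G = (u_X(a) − u_Y(a)) − Σ_{w∉{a,b}}(u_Y(w) − u_X(w))⁺`, FOR THE OPTIMAL COUPLING OF TWO END-HUB LAWS THAT DOMINATE EACH OTHER OFF `{z, b}` (lean-2 GEN-43, ours)

Venture-side (OURS).  Cell `lqcd-flow` (pub-lqcd), unit `pub-lqcd-lean-2-g43`, 2026-08-31.  Chapter AC, file 10 — files 7 and 8 composed: the per-attempt-count analogue of
chapter W's one-pair contraction value (W22 `adjacent_hpers_of_domination` used full domination and the monotone bracket).  Weights `θ ∈ [½, 1]` (`r_min = ½`, `r_max = 1`,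
`Δ = 1`): file 7's signed bracket gives `Φ + e − R_X − R_Y − (Φ+e−2)D⁺ + (Φ+e−1)D⁻ = Φ + e − R_X − R_Y − (Φ+e−2)(D⁺ − D⁻) + D⁻`; file 8 gives `D⁺ − D⁻ = 1 − E_πΔ' = G` exactly and
`D⁻ ≤ (u_Y(z) − u_X(z))⁺`.

* **`adjacent_perStep_bracket`**: `Σ_{α,β} π(α,β)·Δ'(α,β)·(Φ + e − θ_α − θ_β) ≤ (Φ + e − Σu_Xθ − Σu_Yθ) − (Φ+e−2)·[(u_X(a) − u_Y(a)) − Σ_{w∉{a,b}}(u_Y(w) − u_X(w))⁺] + (u_Y(z) − u_X(z))⁺`.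

For the lumped star's `j`-attempt laws (`u_X = cont_* x_j`, `u_Y = cont_* y_j`, Z4's domination off the start content `z`, W15's `u_X(a) − u_Y(a) = x_j(★) + x_j(a) − y_j(a)`):
`E[Ψ'] ≤ Φ + e − R_X − R_Y − (Φ+e−2)·G_j + (y_j(z) − x_j(z))⁺` with Z8's `G_j` — the per-`j` value whose σ-discounted sum the mean condition of files 4–6 needs (file 9 moves
between the truncations and the resolvents; memo MEMO-gen43 §3).  Literature grade (cell rule): OWN, plumbing; nothing cited; no new bib keys.
-/

open Finset
open Literature.Probability.MarkovChains

namespace Summit.Ventures.LatticeQCDFlow.Scaling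

section PerStepBracket
variable {S : Type*} [Fintype S] [DecidableEq S]
variable {NC NX NY : S → ℕ} {a b z : S} {utX utY θ : S → ℝ} {MX MY : S → S → ℕ} {Δ : (S → ℕ) → (S → ℕ) → ℕ} {Φ e : ℝ}

/-- **THE PER-ATTEMPT-COUNT BRACKET OF AN ADJACENT PAIR** (see the module docstring; when the laws dominate each other off `b` alone, take `z := a`). [ours] -/
theorem adjacent_perStep_bracket (hΔ : ∀ N N', Δ N N' = ∑ v, (N v - N' v)) (hab : a ≠ b) (hX : NX = NC + Pi.single a 1) (hY : NY = NC + Pi.single b 1)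
    (hu0X : ∀ w, 0 ≤ utX w) (hu0Y : ∀ w, 0 ≤ utY w) (hu1X : ∑ w, utX w = 1) (hu1Y : ∑ w, utY w = 1)
    (hMX : ∀ α, utX α ≠ 0 → NX = MX α + Pi.single α 1) (hMY : ∀ β, utY β ≠ 0 → NY = MY β + Pi.single β 1)
    (hdom : ∀ w, w ≠ z → w ≠ b → utY w ≤ utX w) (hθ0 : ∀ w, 1 / 2 ≤ θ w) (hθ1 : ∀ w, θ w ≤ 1) :
    ∑ α, ∑ β, optimalCoupling utX utY α β * ((Δ (MX α) (MY β) : ℝ) * (Φ + e - θ α - θ β))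
      ≤ (Φ + e - ∑ w, utX w * θ w - ∑ w, utY w * θ w)
        - (Φ + e - 2) * ((utX a - utY a) - ∑ w, (if w ≠ a ∧ w ≠ b then max (utY w - utX w) 0 else 0)) + max (utY z - utX z) 0 := by
  classical
  have hπ := optimalCoupling_isCoupling hu0X hu0Y hu1X hu1Y
  -- file 7: the signed bracket with `r = θ`, `r_min = ½`, `r_max = 1`, `Δ = 1`
  have hbr := product_bracket_signed (optimalCoupling utX utY) (fun α β => (Δ (MX α) (MY β) : ℝ)) utX utY θ 1 Φ e (1 / 2) 1
    hπ.1 hπ.2.1 hπ.2.2 hu1X hθ0 hθ1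
  -- file 8: `D⁺ − D⁻ = 1 − E_πΔ' = G` and `D⁻ ≤ (u_Y(z) − u_X(z))⁺`
  have hmass := product_signed_mass (optimalCoupling utX utY) (fun α β => (Δ (MX α) (MY β) : ℝ)) utX 1 hπ.2.1 hu1X
  have hexp := adjacent_perStep_expect_eq hΔ hab hX hY hu0X hu0Y hu1X hu1Y hMX hMY (MX := MX) (MY := MY)
  have hgrow := adjacent_perStep_growth_le hΔ hab hX hY hu0X hu0Y hu1X hu1Y hMX hMY hdom (MX := MX) (MY := MY)
  -- `D⁺ = G + D⁻` with `G = (u_X(a) − u_Y(a)) − Σ(u_Y − u_X)⁺`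
  set Dp := ∑ α, ∑ β, optimalCoupling utX utY α β * max (1 - (Δ (MX α) (MY β) : ℝ)) 0 with hDp
  set Dm := ∑ α, ∑ β, optimalCoupling utX utY α β * max ((Δ (MX α) (MY β) : ℝ) - 1) 0 with hDm
  have hG : Dp - Dm = (utX a - utY a) - ∑ w, (if w ≠ a ∧ w ≠ b then max (utY w - utX w) 0 else 0) := by
    have : ∑ α, ∑ β, optimalCoupling utX utY α β * (Δ (MX α) (MY β) : ℝ) = 1 - Dp + Dm := hmass
    linarith [hexp]
  have hDm0 : 0 ≤ Dm := sum_nonneg fun α _ => sum_nonneg fun β _ => mul_nonneg (hπ.1 α β) (le_max_right _ _)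
  calc ∑ α, ∑ β, optimalCoupling utX utY α β * ((Δ (MX α) (MY β) : ℝ) * (Φ + e - θ α - θ β))
      ≤ 1 * (Φ + e - ∑ w, utX w * θ w - ∑ w, utY w * θ w) - (Φ + e - 2 * 1) * Dp + (Φ + e - 2 * (1 / 2)) * Dm := hbr
    _ = (Φ + e - ∑ w, utX w * θ w - ∑ w, utY w * θ w) - (Φ + e - 2) * (Dp - Dm) + Dm := by ring
    _ ≤ (Φ + e - ∑ w, utX w * θ w - ∑ w, utY w * θ w)
        - (Φ + e - 2) * ((utX a - utY a) - ∑ w, (if w ≠ a ∧ w ≠ b then max (utY w - utX w) 0 else 0)) + max (utY z - utX z) 0 := by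
        rw [hG]; linarith [hgrow]

end PerStepBracket

end Summit.Ventures.LatticeQCDFlow.Scaling
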